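import Literature.MathematicalPhysics.QuantumFieldTheory.Balaban1983to89.Node00.Record13CarriersCoPH
import Literature.MathematicalPhysics.QuantumFieldTheory.Balaban1983to89.Node00.Record13CoPHChi

/-!
# NODE 00 (YM-PLAN Track A) — THE STAGE-13 CARRIER STACK AT THE **χ-GENERIC** v1.7 `CoPH` RECORD: dag-n10-d's `Node00/Record13CarriersCoPH` §0 (core-proviso pins), §1 (Stage-5 view
# faces) and §2 (datum faces) RE-ISSUED over `[Ax-3c]`'s χ-generic carriers (`Node00/Record13CoPHChi`: `Stage13HParams.Provisos₁₃CoPHChi`, `Stage13HParams.toStage5₁₃CoPHChi`,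
# `datumOfRecord₁₃CoPHChi`, `SLaw₁₃CoPHChi ∕ TLaw₁₃CoPHChi`) — the χ-FIXED re-binding ∕ pin algebra the K1ᴬ engine's six-pin world reads (WORK ORDER RC-1, director-ym №462 (B) ∕ №467 (D))

WHAT.  dag-n10-d g11's carrier module `Record13CarriersCoPH.lean` (705 l.) is centre-free EXCEPT where it reads the v1.7 CORE provisos, the Stage-5 view, the laws and the CORE datum —
exactly its rows `Stage13HParams.Provisos₁₃CoPH.rebindX ∕ .pinB10 ∕ .pinY ∕ .pinZ ∕ .pinW ∕ .pinB8 ∕ .pinB12 ∕ .pinB8Sub ∕ .pinB13 ∕ .pinB13K ∕ .pinX3 ∕ .pinX3H` (§0, field by field),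
`Stage13HParams.toStage5₁₃CoPH_rebindX ∕ _pinB10 ∕ _pinY ∕ _pinZ ∕ _pinW ∕ _pinB8 ∕ _pinB12_pinB8Sub ∕ _pinB13 ∕ _pinX3 ∕ _pinX3H`, `SLaw₁₃CoPH_TLaw₁₃CoPH_rebindX`,
`Stage13HParams.pinX3_lawsCoPH` (§1, `rfl`), `datumOfRecord₁₃CoPH_rebindX ∕ _pinB10 ∕ … ∕ _pinX3H` (§2, `rfl`, UP-SIDE).  This file is their VERBATIM re-issue with the β-slot small-field
function a FIXED parameter `(χ : ChiSlot F N)` after `θ` (the `[Ax-3b]`∕`[Ax-3c]`∕`[Ax-3d]` recipe of node00-def-Y ∕ node00-def-RR-2: `Provisos₁₃CoPH F N ↦ Provisos₁₃CoPHChi F N χ`,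
`toStage5₁₃CoPH F N ↦ toStage5₁₃CoPHChi F N χ`, `datumOfRecord₁₃CoPH F N θ h ↦ datumOfRecord₁₃CoPHChi F N θ χ h`, `SLaw₁₃CoPH ∕ TLaw₁₃CoPH F N θ ↦ …Chi F N θ χ`; theorem names
`X ↦ X_chi`, dot-rows on the χ structure `Provisos₁₃CoPHChi.<pin>`; the `zetaMeas` row supplied explicitly — its autoParam default is dropped in the χ structure).  The H-level pins
themselves (`Stage13HParams.onBase ∕ rebindX ∕ pin<G>`, §0 of the parent) and all their `rfl` faces at the lower levels are CENTRE-FREE and are read from the parent BY NAME — nothing of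
the parent is re-declared.  WHY χ-FIXED and not centre-map-generic: the pins move `θ.toStage13Params` (the `Y₀ ∕ Z₀ ∕ W₀ ∕ [B10]` carriers live in the lower stages), so at a general
centre map `Χ` the slot `Χ (θ.pin… ).toStage13Params` moves too; at a FIXED χ — and at the Ax centre `chiβOfRecord₁₃Ax θ = chiFixed29Ax F N θ.ν θ.ε₂₉`, which reads `θ.ν`, `θ.ε₂₉` only —
every row is the parent's `rfl` ∕ field-record verbatim (node00-def-RR-2 g26 I.22178 (iii), this seat I.22211).

WHY NOW (seat `pub-ymgap-dag-n24-c` g23, op 5b ENGINE-LANE HAND, dag-lead HANDS I.21531 ∕ WORDS 581): the decl-level cone census of the K1 chain of record (cofinal ENGINE ✓p782234 +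
FACE #11884; `ConeCensusK1.lean`, pub-ymgap INBOX I.22211) lists these 33 carrier rows (+ the 20 `SepCoPH`-layer ones of the sibling file `Record13CarriersSepCoPHChi`) among the
centre-TYPED constants WITHOUT a χ twin that the engine's world reaches: its `up`-binding is the six-pin chain `upOfRecord₅C ((((((θ.rebindX X′).toStage5₁₃CoPH).pinB10).pinY Y₀).pinZ Z₀).pinW W₀) P`
(`…AtAbstractWitnessY0` §1), presented as a record through `N24_isRecordOfRecord₁₃CCoPH_of_up_pinB10Y₀ZW₀` — i.e. through exactly these pin rows.  The Ax re-issue of that engine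
(K1ᴬ stmt-QuantumFields-27239) reads the rows below at `χ := chiβOfRecord₁₃Ax F N θ.toStage13Params`.

WHAT IS HERE (theorems only; append-only NEW leaf; nothing landed is edited; 0 `def`):
* §0χ `Stage13HParams.Provisos₁₃CoPHChi.rebindX ∕ .pinB10 ∕ .pinY ∕ .pinZ ∕ .pinW ∕ .pinB8 ∕ .pinB12 ∕ .pinB8Sub ∕ .pinB13 ∕ .pinB13K ∕ .pinX3 ∕ .pinX3H` (field by field ∕ instances).
* §1χ `Stage13HParams.toStage5₁₃CoPH_rebindX_chi ∕ _pinB10_chi ∕ _pinY_chi ∕ _pinZ_chi ∕ _pinW_chi ∕ _pinB8_chi ∕ _pinB12_pinB8Sub_chi ∕ _pinB13_chi ∕ _pinX3_chi ∕ _pinX3H_chi` (`rfl`),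
  `SLaw₁₃CoPH_TLaw₁₃CoPH_rebindX_chi`, `Stage13HParams.pinX3_lawsCoPH_chi` (`rfl`).
* §2χ `datumOfRecord₁₃CoPH_rebindX_chi ∕ _pinB10_chi ∕ _pinY_chi ∕ _pinZ_chi ∕ _pinW_chi ∕ _pinB8_chi ∕ _pinB12_chi ∕ _pinB8Sub_chi ∕ _pinB13_chi ∕ _pinX3_chi ∕ _pinX3H_chi` (`rfl`, UP-SIDE).

References (objects of record; bookkeeping): [III] = [Balaban1988Convergent] Commun. Math. Phys. **119** (1988), p.244, (2.18) p.257, (2.21) p.258, (3.2)–(3.9) pp.265–266, (3.16)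
p.268, Thm 2 p.263; [V] = [Balaban1989LargeFieldII] Commun. Math. Phys. **122** (1989), Thm 1 + (0.1) pp.355–356; [Balaban1985UV3] Thm 1 p.257; [Balaban1985BackgroundPropagators]
Thm 3.1 p.397; [Balaban1985Variational] Thm 1 p.279; [Balaban1989LargeFieldI] (0.2) p.176; [Balaban1985RegularSpaces] Thm 2 p.83; [Balaban1988RG2Cluster] Lemmas 1–3 pp.9–20; [I] =
[Balaban1987RG1] (2.9) p.266 (the cut-off whose centre χ parametrises).

HONEST FRAMING: kernel bookkeeping only (`rfl`, anonymous-constructor records on landed χ-generic structures); NO estimate; nothing of Bałaban's asserted; provisos stay HYPOTHESES; no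
proviso inhabited; no node discharged; K0ᴬ∕K1ᴬ∕K3ᴬ OPEN; counts unmoved (discharged 8∕27 · K 1∕4); a re-issue is not progress on any estimate; one finite 𝕋⁴ programme at fixed
ε = L^{−K} — NOT continuum ∕ ℝ⁴ ∕ OS ∕ mass gap ∕ Clay.  No `sorry`, no `axiom`, no `instance`, no `notation`; standard axioms.  Seat `pub-ymgap-dag-n24-c` g23 (`--supports
stmt-QuantumFields-27239 --as helper`, count-neutral).
-/

noncomputable section

namespace Literature.MathematicalPhysics.QuantumFieldTheory.Balaban1983to89.Node00

open T4Continuum AveragingRT T4FiniteEpsInhabited FlowStep FlowStepRuns DagBinding T4DatumAssembly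
open scoped Matrix.Norms.L2Operator

variable (F : T4Family) (N : ℕ) [NeZero N]

/-! ## §0χ. The χ-generic CORE provisos transport along every `X`-re-binding and every pin (field by field; the rows read `θ.toStage13Params`, `θ.Zh`, `θ.Rz` — no carrier) -/

section RPinsChi

variable {F N}
/-- **The CORE provisos of the v1.7 parameters read no carrier**: they transport along ANY `X`-re-binding (field by field; the residual 𝐓-weight rows read `θ.Zh`, kept).
[cite: Balaban1988Convergent, (2.18) p.257, (2.21) p.258, (3.2)–(3.9) pp.265–266, (3.16) p.268 (bookkeeping)] -/
theorem Stage13HParams.Provisos₁₃CoPHChi.rebindX {θ : Stage13HParams F N} {χ : ChiSlot F N} (h : θ.Provisos₁₃CoPHChi F N χ) (X' : B12.RunParams → PrintedCarriersR) :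
    (θ.rebindX F N X').Provisos₁₃CoPHChi F N χ :=
  { intPiece := h.intPiece, measω := h.measω, measChi := h.measChi, zetaUnity := h.zetaUnity, zetaAbs := h.zetaAbs, rstep := h.rstep, rzLaws := h.rzLaws,
    zhLaws := h.zhLaws, zhLocal := h.zhLocal, zetaMeas := h.zetaMeas }

/-- … along the [B10] pin … [cite: Balaban1988Convergent, (2.18) p.257 (bookkeeping)] -/
theorem Stage13HParams.Provisos₁₃CoPHChi.pinB10 {θ : Stage13HParams F N} {χ : ChiSlot F N} (h : θ.Provisos₁₃CoPHChi F N χ) : (θ.pinB10 F N).Provisos₁₃CoPHChi F N χ :=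
  h.rebindX _

/-- … the Y pin … [cite: Balaban1988Convergent, (2.18) p.257 (bookkeeping)] -/
theorem Stage13HParams.Provisos₁₃CoPHChi.pinY {θ : Stage13HParams F N} {χ : ChiSlot F N} (h : θ.Provisos₁₃CoPHChi F N χ) (Y₀ : PrintedCarriers9X) : (θ.pinY F N Y₀).Provisos₁₃CoPHChi F N χ :=
  { intPiece := h.intPiece, measω := h.measω, measChi := h.measChi, zetaUnity := h.zetaUnity, zetaAbs := h.zetaAbs, rstep := h.rstep, rzLaws := h.rzLaws,
    zhLaws := h.zhLaws, zhLocal := h.zhLocal, zetaMeas := h.zetaMeas }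

/-- … the Z pin … [cite: Balaban1988Convergent, (2.18) p.257 (bookkeeping)] -/
theorem Stage13HParams.Provisos₁₃CoPHChi.pinZ {θ : Stage13HParams F N} {χ : ChiSlot F N} (h : θ.Provisos₁₃CoPHChi F N χ) (Z₀ : PrintedCarriers11) : (θ.pinZ F N Z₀).Provisos₁₃CoPHChi F N χ :=
  { intPiece := h.intPiece, measω := h.measω, measChi := h.measChi, zetaUnity := h.zetaUnity, zetaAbs := h.zetaAbs, rstep := h.rstep, rzLaws := h.rzLaws,
    zhLaws := h.zhLaws, zhLocal := h.zhLocal, zetaMeas := h.zetaMeas }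

/-- … the W pin … [cite: Balaban1988Convergent, (2.18) p.257 (bookkeeping)] -/
theorem Stage13HParams.Provisos₁₃CoPHChi.pinW {θ : Stage13HParams F N} {χ : ChiSlot F N} (h : θ.Provisos₁₃CoPHChi F N χ) (W₀ : B12.RunParams → PrintedCarriers15) :
    (θ.pinW F N W₀).Provisos₁₃CoPHChi F N χ :=
  { intPiece := h.intPiece, measω := h.measω, measChi := h.measChi, zetaUnity := h.zetaUnity, zetaAbs := h.zetaAbs, rstep := h.rstep, rzLaws := h.rzLaws,
    zhLaws := h.zhLaws, zhLocal := h.zhLocal, zetaMeas := h.zetaMeas }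

/-- … the [B8] pin … [cite: Balaban1988Convergent, (2.18) p.257 (bookkeeping)] -/
theorem Stage13HParams.Provisos₁₃CoPHChi.pinB8 {θ : Stage13HParams F N} {χ : ChiSlot F N} (h : θ.Provisos₁₃CoPHChi F N χ) (lam : ResidB8 θ.toStage3Params) : (θ.pinB8 F N lam).Provisos₁₃CoPHChi F N χ :=
  h.rebindX _

/-- … the [B12] pin … [cite: Balaban1988Convergent, (2.18) p.257 (bookkeeping)] -/
theorem Stage13HParams.Provisos₁₃CoPHChi.pinB12 {θ : Stage13HParams F N} {χ : ChiSlot F N} (h : θ.Provisos₁₃CoPHChi F N χ) (lam : ResidB12 F N θ.τ9.M) : (θ.pinB12 F N lam).Provisos₁₃CoPHChi F N χ :=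
  h.rebindX _

/-- … the [B8′] pin … [cite: Balaban1988Convergent, (2.18) p.257 (bookkeeping)] -/
theorem Stage13HParams.Provisos₁₃CoPHChi.pinB8Sub {θ : Stage13HParams F N} {χ : ChiSlot F N} (h : θ.Provisos₁₃CoPHChi F N χ) (lam : ResidB8 θ.toStage3Params) : (θ.pinB8Sub F N lam).Provisos₁₃CoPHChi F N χ :=
  h.rebindX _

/-- … the [B13] pin … [cite: Balaban1988Convergent, (2.18) p.257; Balaban1988RG2Cluster, Lemmas 1–3 pp.9–20 (bookkeeping)] -/
theorem Stage13HParams.Provisos₁₃CoPHChi.pinB13 {θ : Stage13HParams F N} {χ : ChiSlot F N} (h : θ.Provisos₁₃CoPHChi F N χ) (lam : B12.RunParams → ResidB13 θ.toStage3Params) :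
    (θ.pinB13 F N lam).Provisos₁₃CoPHChi F N χ :=
  h.rebindX _

/-- … the kernel-keyed [B13] pin … [cite: Balaban1988RG2Cluster, Lemmas 1–3 pp.9–20, (2.14) p.15 (bookkeeping)] -/
theorem Stage13HParams.Provisos₁₃CoPHChi.pinB13K {θ : Stage13HParams F N} {χ : ChiSlot F N} (h : θ.Provisos₁₃CoPHChi F N χ) (lamK : B12.RunParams → ResidB13K θ.toStage3Params) :
    (θ.pinB13K F N lamK).Provisos₁₃CoPHChi F N χ :=
  h.rebindX _

/-- … the one-level X-pin … [cite: Balaban1988Convergent, (2.18) p.257 (bookkeeping)] -/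
theorem Stage13HParams.Provisos₁₃CoPHChi.pinX3 {θ : Stage13HParams F N} {χ : ChiSlot F N} (h : θ.Provisos₁₃CoPHChi F N χ) (lam8 : ResidB8 θ.toStage3Params) (lam12 : ResidB12 F N θ.τ9.M)
    (lam13 : B12.RunParams → ResidB13 θ.toStage3Params) : (θ.pinX3 F N lam8 lam12 lam13).Provisos₁₃CoPHChi F N χ :=
  h.rebindX _

/-- … and the repaired one-level X-pin. [cite: Balaban1988Convergent, (2.18) p.257 (bookkeeping)] -/
theorem Stage13HParams.Provisos₁₃CoPHChi.pinX3H {θ : Stage13HParams F N} {χ : ChiSlot F N} (h : θ.Provisos₁₃CoPHChi F N χ) (lam8 : ResidB8 θ.toStage3Params) (lam12 : ResidB12 F N θ.τ9.M)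
    (lam13 : B12.RunParams → ResidB13 θ.toStage3Params) : (θ.pinX3H F N lam8 lam12 lam13).Provisos₁₃CoPHChi F N χ :=
  h.rebindX _

end RPinsChi

/-! ## §1χ. The χ-generic Stage-5 view `toStage5₁₃CoPHChi` commutes with every `X`-re-binding and every pin; the χ-generic laws read no carrier (`rfl`) -/

section FacesChi

/-- **The Stage-13 view commutes with re-binding `X`** (`rfl`, once, at a generic re-binding: `residualOfStage13`'s pinned fields read no carrier).
[cite: Balaban1988Convergent, p.244 (bookkeeping)] -/
theorem Stage13HParams.toStage5₁₃CoPH_rebindX_chi (θ : Stage13HParams F N) (χ : ChiSlot F N) (X' : B12.RunParams → PrintedCarriersR) :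
    (θ.rebindX F N X').toStage5₁₃CoPHChi F N χ = (θ.toStage5₁₃CoPHChi F N χ).rebindX F N X' := rfl

/-- The Stage-13 view of [B10]-pinned parameters IS the [B10]-pinned Stage-13 view (`rfl`). [cite: Balaban1985UV3, (1)–(5) p.256 (bookkeeping)] -/
theorem Stage13HParams.toStage5₁₃CoPH_pinB10_chi (θ : Stage13HParams F N) (χ : ChiSlot F N) : (θ.pinB10 F N).toStage5₁₃CoPHChi F N χ = (θ.toStage5₁₃CoPHChi F N χ).pinB10 F N :=
  Stage13HParams.toStage5₁₃CoPH_rebindX_chi F N θ χ _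

/-- … Y (`rfl`) … [cite: Balaban1985BackgroundPropagators, Thm 3.1 p.397 (bookkeeping)] -/
theorem Stage13HParams.toStage5₁₃CoPH_pinY_chi (θ : Stage13HParams F N) (χ : ChiSlot F N) (Y₀ : PrintedCarriers9X) : (θ.pinY F N Y₀).toStage5₁₃CoPHChi F N χ = (θ.toStage5₁₃CoPHChi F N χ).pinY F N Y₀ := rfl

/-- … Z (`rfl`) … [cite: Balaban1985Variational, Thm 1 p.279 (bookkeeping)] -/
theorem Stage13HParams.toStage5₁₃CoPH_pinZ_chi (θ : Stage13HParams F N) (χ : ChiSlot F N) (Z₀ : PrintedCarriers11) : (θ.pinZ F N Z₀).toStage5₁₃CoPHChi F N χ = (θ.toStage5₁₃CoPHChi F N χ).pinZ F N Z₀ := rfl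

/-- … W (`rfl`) … [cite: Balaban1989LargeFieldI, (0.2) p.176 (bookkeeping)] -/
theorem Stage13HParams.toStage5₁₃CoPH_pinW_chi (θ : Stage13HParams F N) (χ : ChiSlot F N) (W₀ : B12.RunParams → PrintedCarriers15) :
    (θ.pinW F N W₀).toStage5₁₃CoPHChi F N χ = (θ.toStage5₁₃CoPHChi F N χ).pinW F N W₀ := rfl

/-- … [B8] (`rfl`) … [cite: Balaban1985RegularSpaces, Thm 2 p.83 (bookkeeping)] -/
theorem Stage13HParams.toStage5₁₃CoPH_pinB8_chi (θ : Stage13HParams F N) (χ : ChiSlot F N) (lam : ResidB8 θ.toStage3Params) :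
    (θ.pinB8 F N lam).toStage5₁₃CoPHChi F N χ = (θ.toStage5₁₃CoPHChi F N χ).pinB8 F N lam :=
  Stage13HParams.toStage5₁₃CoPH_rebindX_chi F N θ χ _

/-- … [B12] and [B8′] (`rfl` ×2, through `toStage5₁₃CoPH_rebindX`). [cite: Balaban1988Convergent, p.244 (bookkeeping)] -/
theorem Stage13HParams.toStage5₁₃CoPH_pinB12_pinB8Sub_chi (θ : Stage13HParams F N) (χ : ChiSlot F N) (lam : ResidB12 F N θ.τ9.M) (lam8 : ResidB8 θ.toStage3Params) :
    (θ.pinB12 F N lam).toStage5₁₃CoPHChi F N χ = (θ.toStage5₁₃CoPHChi F N χ).rebindX F N (XB12OfRecord₁₂ F N θ.toStage12Params lam θ.res.X) ∧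
    (θ.pinB8Sub F N lam8).toStage5₁₃CoPHChi F N χ = (θ.toStage5₁₃CoPHChi F N χ).rebindX F N (fun P => (θ.res.X P).withB8OfRecordSub θ.toStage3Params lam8) :=
  ⟨Stage13HParams.toStage5₁₃CoPH_rebindX_chi F N θ χ _, Stage13HParams.toStage5₁₃CoPH_rebindX_chi F N θ χ _⟩

/-- The Stage-13 view of [B13]-pinned parameters IS the re-bound Stage-13 view (`Record13Carriers.Stage13HParams.toStage5₁₃CoPH_rebindX_chi`). [cite: Balaban1988Convergent, p.244 (bookkeeping)] -/
theorem Stage13HParams.toStage5₁₃CoPH_pinB13_chi (θ : Stage13HParams F N) (χ : ChiSlot F N) (lam : B12.RunParams → ResidB13 θ.toStage3Params) :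
    (θ.pinB13 F N lam).toStage5₁₃CoPHChi F N χ = (θ.toStage5₁₃CoPHChi F N χ).rebindX F N (XB13OfRecord θ.toStage3Params lam θ.res.X) :=
  Stage13HParams.toStage5₁₃CoPH_rebindX_chi F N θ χ _

/-- The Stage-13 view of the pinned parameter IS the re-bound Stage-13 view (`toStage5₁₃CoPH_rebindX`). [cite: Balaban1988Convergent, p.244 (bookkeeping)] -/
theorem Stage13HParams.toStage5₁₃CoPH_pinX3_chi (θ : Stage13HParams F N) (χ : ChiSlot F N) (lam8 : ResidB8 θ.toStage3Params) (lam12 : ResidB12 F N θ.τ9.M)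
    (lam13 : B12.RunParams → ResidB13 θ.toStage3Params) :
    (θ.pinX3 F N lam8 lam12 lam13).toStage5₁₃CoPHChi F N χ = (θ.toStage5₁₃CoPHChi F N χ).rebindX F N (XPinned₁₃ F N θ.toStage13Params lam8 lam12 lam13) :=
  Stage13HParams.toStage5₁₃CoPH_rebindX_chi F N θ χ _

/-- … and of the REPAIRED pinned parameter (`toStage5₁₃CoPH_rebindX` at dag-n05-d's `XPinned₁₃H`). [cite: Balaban1988Convergent, p.244 (bookkeeping)] -/
theorem Stage13HParams.toStage5₁₃CoPH_pinX3H_chi (θ : Stage13HParams F N) (χ : ChiSlot F N) (lam8 : ResidB8 θ.toStage3Params) (lam12 : ResidB12 F N θ.τ9.M)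
    (lam13 : B12.RunParams → ResidB13 θ.toStage3Params) :
    (θ.pinX3H F N lam8 lam12 lam13).toStage5₁₃CoPHChi F N χ = (θ.toStage5₁₃CoPHChi F N χ).rebindX F N (XPinned₁₃H F N θ.toStage13Params lam8 lam12 lam13) :=
  Stage13HParams.toStage5₁₃CoPH_rebindX_chi F N θ χ _

/-- … nor the §2-format law and the 𝐓-image law of record (`rfl` ×2). [cite: Balaban1988Convergent, (2.18) p.257, Thm 2 p.263 (bookkeeping)] -/
theorem SLaw₁₃CoPH_TLaw₁₃CoPH_rebindX_chi (θ : Stage13HParams F N) (χ : ChiSlot F N) (X' : B12.RunParams → PrintedCarriersR) :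
    SLaw₁₃CoPHChi F N (θ.rebindX F N X') χ = SLaw₁₃CoPHChi F N θ χ ∧ TLaw₁₃CoPHChi F N (θ.rebindX F N X') χ = TLaw₁₃CoPHChi F N θ χ := ⟨rfl, rfl⟩

/-- **The §2-format law and the 𝐓-image law AT PRINT'S BACKGROUND (`SLaw₁₃CoPH`, `TLaw₁₃CoPH`) do not read the carrier bundle either** — at the one-level X-pin
(instances of `SLaw₁₃CoPH_TLaw₁₃CoPH_rebindX_chi`; the five background-free objects are `pinX3_histories`'). [cite: Balaban1988Convergent, (2.18) p.257, Thm 2 p.263 (bookkeeping)] -/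
theorem Stage13HParams.pinX3_lawsCoPH_chi (θ : Stage13HParams F N) (χ : ChiSlot F N) (lam8 : ResidB8 θ.toStage3Params) (lam12 : ResidB12 F N θ.τ9.M)
    (lam13 : B12.RunParams → ResidB13 θ.toStage3Params) :
    SLaw₁₃CoPHChi F N (θ.pinX3 F N lam8 lam12 lam13) χ = SLaw₁₃CoPHChi F N θ χ ∧ TLaw₁₃CoPHChi F N (θ.pinX3 F N lam8 lam12 lam13) χ = TLaw₁₃CoPHChi F N θ χ :=
  ⟨(SLaw₁₃CoPH_TLaw₁₃CoPH_rebindX_chi F N θ χ _).1, (SLaw₁₃CoPH_TLaw₁₃CoPH_rebindX_chi F N θ χ _).2⟩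

end FacesChi

/-! ## §2χ. The χ-generic CORE datum `datumOfRecord₁₃CoPHChi` (key `h : θ.Provisos₁₃CoPHChi F N χ`) is UP-SIDE along every re-binding and pin (`rfl`) -/

section DatumChi

/-- **THE CORE-KEYED DATUM DOES NOT READ THE CARRIER BUNDLE `X`** (`rfl`, once, at a generic re-binding). [cite: Balaban1989LargeFieldII, Thm 1 + (0.1) pp.355–356 (bookkeeping)] -/
theorem datumOfRecord₁₃CoPH_rebindX_chi (θ : Stage13HParams F N) (χ : ChiSlot F N) (h : θ.Provisos₁₃CoPHChi F N χ) (X' : B12.RunParams → PrintedCarriersR)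
    (h' : (θ.rebindX F N X').Provisos₁₃CoPHChi F N χ) : datumOfRecord₁₃CoPHChi F N (θ.rebindX F N X') χ h' = datumOfRecord₁₃CoPHChi F N θ χ h := rfl

/-- The [B10] pin is UP-SIDE at the core-keyed datum (`rfl`) … [cite: Balaban1989LargeFieldII, Thm 1 + (0.1) pp.355–356 (bookkeeping)] -/
theorem datumOfRecord₁₃CoPH_pinB10_chi (θ : Stage13HParams F N) (χ : ChiSlot F N) (h : θ.Provisos₁₃CoPHChi F N χ) :
    datumOfRecord₁₃CoPHChi F N (θ.pinB10 F N) χ h.pinB10 = datumOfRecord₁₃CoPHChi F N θ χ h :=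
  datumOfRecord₁₃CoPH_rebindX_chi F N θ χ h _ h.pinB10

/-- … the Y pin (`rfl`) … [cite: Balaban1989LargeFieldII, Thm 1 + (0.1) pp.355–356 (bookkeeping)] -/
theorem datumOfRecord₁₃CoPH_pinY_chi (θ : Stage13HParams F N) (χ : ChiSlot F N) (h : θ.Provisos₁₃CoPHChi F N χ) (Y₀ : PrintedCarriers9X) :
    datumOfRecord₁₃CoPHChi F N (θ.pinY F N Y₀) χ (h.pinY Y₀) = datumOfRecord₁₃CoPHChi F N θ χ h := rfl

/-- … the Z pin (`rfl`) … [cite: Balaban1989LargeFieldII, Thm 1 + (0.1) pp.355–356 (bookkeeping)] -/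
theorem datumOfRecord₁₃CoPH_pinZ_chi (θ : Stage13HParams F N) (χ : ChiSlot F N) (h : θ.Provisos₁₃CoPHChi F N χ) (Z₀ : PrintedCarriers11) :
    datumOfRecord₁₃CoPHChi F N (θ.pinZ F N Z₀) χ (h.pinZ Z₀) = datumOfRecord₁₃CoPHChi F N θ χ h := rfl

/-- … the W pin (`rfl`) … [cite: Balaban1989LargeFieldII, Thm 1 + (0.1) pp.355–356 (bookkeeping)] -/
theorem datumOfRecord₁₃CoPH_pinW_chi (θ : Stage13HParams F N) (χ : ChiSlot F N) (h : θ.Provisos₁₃CoPHChi F N χ) (W₀ : B12.RunParams → PrintedCarriers15) :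
    datumOfRecord₁₃CoPHChi F N (θ.pinW F N W₀) χ (h.pinW W₀) = datumOfRecord₁₃CoPHChi F N θ χ h := rfl

/-- … the [B8] pin (`rfl`) … [cite: Balaban1989LargeFieldII, Thm 1 + (0.1) pp.355–356 (bookkeeping)] -/
theorem datumOfRecord₁₃CoPH_pinB8_chi (θ : Stage13HParams F N) (χ : ChiSlot F N) (h : θ.Provisos₁₃CoPHChi F N χ) (lam : ResidB8 θ.toStage3Params) :
    datumOfRecord₁₃CoPHChi F N (θ.pinB8 F N lam) χ (h.pinB8 lam) = datumOfRecord₁₃CoPHChi F N θ χ h :=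
  datumOfRecord₁₃CoPH_rebindX_chi F N θ χ h _ (h.pinB8 lam)

/-- … the [B12] pin (`rfl`) … [cite: Balaban1989LargeFieldII, Thm 1 + (0.1) pp.355–356 (bookkeeping)] -/
theorem datumOfRecord₁₃CoPH_pinB12_chi (θ : Stage13HParams F N) (χ : ChiSlot F N) (h : θ.Provisos₁₃CoPHChi F N χ) (lam : ResidB12 F N θ.τ9.M) :
    datumOfRecord₁₃CoPHChi F N (θ.pinB12 F N lam) χ (h.pinB12 lam) = datumOfRecord₁₃CoPHChi F N θ χ h :=
  datumOfRecord₁₃CoPH_rebindX_chi F N θ χ h _ (h.pinB12 lam)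

/-- … the [B8′] pin (`rfl`) … [cite: Balaban1989LargeFieldII, Thm 1 + (0.1) pp.355–356 (bookkeeping)] -/
theorem datumOfRecord₁₃CoPH_pinB8Sub_chi (θ : Stage13HParams F N) (χ : ChiSlot F N) (h : θ.Provisos₁₃CoPHChi F N χ) (lam : ResidB8 θ.toStage3Params) :
    datumOfRecord₁₃CoPHChi F N (θ.pinB8Sub F N lam) χ (h.pinB8Sub lam) = datumOfRecord₁₃CoPHChi F N θ χ h :=
  datumOfRecord₁₃CoPH_rebindX_chi F N θ χ h _ (h.pinB8Sub lam)

/-- … the [B13] pin (`rfl`) … [cite: Balaban1989LargeFieldII, Thm 1 + (0.1) pp.355–356 (bookkeeping)] -/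
theorem datumOfRecord₁₃CoPH_pinB13_chi (θ : Stage13HParams F N) (χ : ChiSlot F N) (h : θ.Provisos₁₃CoPHChi F N χ) (lam : B12.RunParams → ResidB13 θ.toStage3Params) :
    datumOfRecord₁₃CoPHChi F N (θ.pinB13 F N lam) χ (h.pinB13 lam) = datumOfRecord₁₃CoPHChi F N θ χ h :=
  datumOfRecord₁₃CoPH_rebindX_chi F N θ χ h _ (h.pinB13 lam)

/-- … and the one-level X-pin (`rfl`). [cite: Balaban1989LargeFieldII, Thm 1 + (0.1) pp.355–356 (bookkeeping)] -/
theorem datumOfRecord₁₃CoPH_pinX3_chi (θ : Stage13HParams F N) (χ : ChiSlot F N) (h : θ.Provisos₁₃CoPHChi F N χ) (lam8 : ResidB8 θ.toStage3Params) (lam12 : ResidB12 F N θ.τ9.M)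
    (lam13 : B12.RunParams → ResidB13 θ.toStage3Params) :
    datumOfRecord₁₃CoPHChi F N (θ.pinX3 F N lam8 lam12 lam13) χ (h.pinX3 lam8 lam12 lam13) = datumOfRecord₁₃CoPHChi F N θ χ h :=
  datumOfRecord₁₃CoPH_rebindX_chi F N θ χ h _ (h.pinX3 lam8 lam12 lam13)

/-- … and the repaired one-level X-pin (`rfl`). [cite: Balaban1989LargeFieldII, Thm 1 + (0.1) pp.355–356 (bookkeeping)] -/
theorem datumOfRecord₁₃CoPH_pinX3H_chi (θ : Stage13HParams F N) (χ : ChiSlot F N) (h : θ.Provisos₁₃CoPHChi F N χ) (lam8 : ResidB8 θ.toStage3Params) (lam12 : ResidB12 F N θ.τ9.M)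
    (lam13 : B12.RunParams → ResidB13 θ.toStage3Params) :
    datumOfRecord₁₃CoPHChi F N (θ.pinX3H F N lam8 lam12 lam13) χ (h.pinX3H lam8 lam12 lam13) = datumOfRecord₁₃CoPHChi F N θ χ h :=
  datumOfRecord₁₃CoPH_rebindX_chi F N θ χ h _ (h.pinX3H lam8 lam12 lam13)

end DatumChi

end Literature.MathematicalPhysics.QuantumFieldTheory.Balaban1983to89.Node00

end
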